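import Literature.MeasureTheory.Group.CoveringWeightsPushforwardSup
import Literature.NumberTheory.Automorphic.UnitaryGroupTorusIdeleUnfolding
import Literature.NumberTheory.Automorphic.AdeleGaloisDescent
import Literature.NumberTheory.Automorphic.RelNormOneTorus
import HarnessLib

/-!
# Idele-norm unfolding: `∫_{E^×∖𝕀_E} g(N_{E/F} x) dx = K · ∫_{𝓕_F ∩ F^× N(𝕀_E)} g`
(Rogawski, *Automorphic Representations of Unitary Groups in Three Variables* (1990), §7.2 p. 94: «`α₃` defines an
isomorphism of `MS∖M` with `NE^*∖NI_E`», `∫_{𝐙M∖𝐌} … = m(𝐙S∖𝐒) ∫_{NE^*∖NI_E} …`; Cassels–Fröhlich, Ch. VII §2, §6 for the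
norm on ideles and idele classes)

Topic `NumberTheory/Automorphic`; namespace `Literature.NumberTheory.Automorphic`. THEOREMS ONLY over accepted tree modules:
no definition, no named fact, no instance, no notation, no `sorry`. Row (C-torus) FILE 3b of the T1-qs LAW 5 road of
`Cruxes/H413/Lines/F0_T1InnerFormTraceIdentity.lean` (cell `pub/hodgecm-mathlib`, crux H413): the IDELE INSTANCE of the generic
★ `CoveringWeightsPushforwardSup.exists_lintegral_comp_mul_weight_eq_mul_setLIntegral_inter_sup` at

  `α = N_{E/F} = AdeleRing.ideleRelNorm F E : 𝕀_E →* 𝕀_F`, `Γ = Eˣ = principalIdeles E`, `P = Fˣ = principalIdeles F`,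

so that `H = P ⊔ α(𝕀_E) = Fˣ · N_{E/F}(𝕀_E)` — for a quadratic `E = F(√d)` this is `principalIdeles F ⊔ normIdeles F d`
(★ `range_ideleRelNorm_eq_normIdeles`), the open subgroup of index two of ★ `QuadraticNormIndex`, and `𝓕 ∩ H` is the set
over which ★ `TateTruncatedZetaCoefficientsLinear.setIntegral_inter_eq_half_add_half_mul` splits an `F`-idele class integral.

INPUTS kept as hypotheses (both are theorems of class field theory, discharged by the caller in its own currency):
`hH : IsOpen (Fˣ · N(𝕀_E))` (for `E = F(√θ)`, `θ ∈ 𝓞 F`: ★ `isOpen_principalIdeles_sup_normIdeles` with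
★ `range_ideleRelNorm_eq_normIdeles`) and HASSE'S NORM THEOREM in the form
`hHasse : ∀ k ∈ Fˣ, k ∈ N(𝕀_E) → ∃ e ∈ Eˣ, N e = k` (quadratic case: ★ `principal_mem_range_ideleRelNorm_iff_exists`,
O'Meara 65:23). The fibre input — compactness of `E¹∖𝕀_E^{N=1}` — is ★ `compactSpace_relNormOneQuot` (Godement) via
★ `exists_isCompact_forall_exists_mul_mem`.

* `map_principalIdeles_ideleRelNorm_le` — `N(Eˣ) ≤ Fˣ` (★ `AdeleRing.ideleRelNorm_mem_principalIdeles`).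
* `mem_relNormOneIdeles_of_ideleRelNorm_eq_one` — `N x = 1 → x ∈ U(1)_{E/F}(𝔸_F)`.
* `exists_isCompact_principalIdeles_translate_of_ideleRelNorm_mem` — Hasse + Godement: a compact `C ⊆ 𝕀_E` meeting every
  `Eˣ`-orbit of `N⁻¹(Fˣ)`.
* **`exists_lintegral_comp_ideleRelNorm_mul_weight_eq_setLIntegral`** — THE ROW: `∃ K ∈ (0, ∞)`, for every `Eˣ`-covering
  weight `wE`, every `F`-idele class domain `𝓕` and every Borel `Fˣ`-invariant `g ≥ 0` on `𝕀_F`: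
  **`∫⁻ x, g (N x) * wE x ∂μE = K * ∫⁻ y in 𝓕 ∩ ↑(principalIdeles F ⊔ N.range), g y ∂μF`**;
  `…_setLIntegral_setLIntegral` — the same with an `E`-idele class domain `𝓕_E` on the left.

## References

* J. D. Rogawski, *Automorphic Representations of Unitary Groups in Three Variables*, Ann. of Math. Stud. 123 (1990), §7.2
  (p. 94) [Rogawski1990].
* J. W. S. Cassels, A. Fröhlich (eds.), *Algebraic Number Theory* (1967), Ch. VII §2, §6 [CasselsFrohlichANT1967].
* R. Godement, *Domaines fondamentaux des groupes arithmétiques*, Sém. Bourbaki 257 (1964), §5 Thm. 4 [Godement1964].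
-/

set_option autoImplicit false

noncomputable section

open MeasureTheory Measure NumberField IsDedekindDomain Set Literature.MeasureTheory.Group
open scoped ENNReal NNReal

namespace Literature.NumberTheory.Automorphic

variable {F E : Type} [Field F] [NumberField F] [Field E] [NumberField E] [Algebra F E] [IsGalois F E]

/-- **`N_{E/F}(Eˣ) ≤ Fˣ`** as subgroups of `𝕀_F` (★ `AdeleRing.ideleRelNorm_mem_principalIdeles`).
[cite: CasselsFrohlichANT1967, Ch. VII §2] -/
theorem map_principalIdeles_ideleRelNorm_le :
    (GaloisRepresentations.principalIdeles E).map (AdeleRing.ideleRelNorm F E) ≤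
      GaloisRepresentations.principalIdeles F := by
  rintro _ ⟨e, he, rfl⟩
  exact AdeleRing.ideleRelNorm_mem_principalIdeles F E he

/-- An idele of relative norm one lies in the norm-one torus `U(1)_{E/F}(𝔸_F) = relNormOneIdeles F E`
(`(N x)_E = ∏_σ σ • x`, ★ `AdeleRing.ideleRelNorm_eq_iff`). [cite: CasselsFrohlichANT1967, Ch. VII §2] -/
theorem mem_relNormOneIdeles_of_ideleRelNorm_eq_one {x : (AdeleRing (𝓞 E) E)ˣ}
    (hx : AdeleRing.ideleRelNorm F E x = 1) : x ∈ relNormOneIdeles F E := by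
  rw [mem_relNormOneIdeles_iff, ← (AdeleRing.ideleRelNorm_eq_iff (F := F) (E := E)).1 hx, map_one]

/-- **Hasse + Godement: a compact set of representatives for `Eˣ` on `N⁻¹(Fˣ)`.** If every principal idele of `F` that
is the norm of an idele of `E` is the norm of a PRINCIPAL idele (Hasse's norm theorem), then there is a compact
`C ⊆ 𝕀_E` such that every `x ∈ 𝕀_E` with `N x ∈ Fˣ` has an `Eˣ`-translate in `C`: write `N x = N e`, so `e⁻¹ x` has norm
one, and move it into Godement's compactum of `U(1)_{E/F}(𝔸_F)` (★ `compactSpace_relNormOneQuot`,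
★ `exists_isCompact_forall_exists_mul_mem`) by an element of `E¹`. [cite: Godement1964, §5 Thm. 4]
[cite: CasselsFrohlichANT1967, Ch. VII §6] -/
theorem exists_isCompact_principalIdeles_translate_of_ideleRelNorm_mem
    (hHasse : ∀ k ∈ GaloisRepresentations.principalIdeles F, k ∈ (AdeleRing.ideleRelNorm F E).range →
      ∃ e ∈ GaloisRepresentations.principalIdeles E, AdeleRing.ideleRelNorm F E e = k) :
    ∃ C : Set (AdeleRing (𝓞 E) E)ˣ, IsCompact C ∧
      ∀ x : (AdeleRing (𝓞 E) E)ˣ, AdeleRing.ideleRelNorm F E x ∈ GaloisRepresentations.principalIdeles F →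
        ∃ γ ∈ GaloisRepresentations.principalIdeles E, γ * x ∈ C := by
  obtain ⟨C₁, hC₁c, hC₁⟩ := UnitaryGroup.exists_isCompact_forall_exists_mul_mem (relNormOneRat F E)
  refine ⟨Subtype.val '' C₁, hC₁c.image continuous_subtype_val, fun x hx => ?_⟩
  obtain ⟨e, he, hex⟩ := hHasse _ hx ⟨x, rfl⟩
  -- `y = e⁻¹ x` has relative norm one
  have hy : e⁻¹ * x ∈ relNormOneIdeles F E :=
    mem_relNormOneIdeles_of_ideleRelNorm_eq_one (by rw [map_mul, map_inv, hex, inv_mul_cancel])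
  obtain ⟨γ₁, hγ₁, hyγ⟩ := hC₁ ⟨e⁻¹ * x, hy⟩
  refine ⟨e⁻¹ * (γ₁ : (AdeleRing (𝓞 E) E)ˣ), (GaloisRepresentations.principalIdeles E).mul_mem
    ((GaloisRepresentations.principalIdeles E).inv_mem he) ((mem_relNormOneRat_iff F E γ₁).1 hγ₁), ?_⟩
  refine ⟨_, hyγ, ?_⟩
  show e⁻¹ * x * (γ₁ : (AdeleRing (𝓞 E) E)ˣ) = e⁻¹ * (γ₁ : (AdeleRing (𝓞 E) E)ˣ) * x
  rw [mul_right_comm]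

variable [MeasurableSpace (AdeleRing (𝓞 E) E)ˣ] [BorelSpace (AdeleRing (𝓞 E) E)ˣ]
  [MeasurableSpace (AdeleRing (𝓞 F) F)ˣ] [BorelSpace (AdeleRing (𝓞 F) F)ˣ]

/-- **IDELE-NORM UNFOLDING.** Let `E/F` be a Galois extension of number fields with Haar measures `μE` on `𝕀_E` and `μF` on
`𝕀_F`, suppose `H = Fˣ · N_{E/F}(𝕀_E)` is open (`hH`) and Hasse's norm theorem holds in the form `hHasse` (both automatic for
`E/F` quadratic, see the module docstring). Then there is `K ∈ (0, ∞)` such that for every covering weight `wE` of the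
principal ideles of `E`, every idele class domain `𝓕` of `F` (`IsIdeleClassDomain F 𝓕`) and every Borel `Fˣ`-invariant
`g : 𝕀_F → [0, ∞]`:

  `∫⁻ g(N x) wE(x) dμE = K · ∫⁻_{𝓕 ∩ H} g dμF` — i.e. `∫_{Eˣ∖𝕀_E} g ∘ N = K ∫_{Fˣ∖Fˣ N(𝕀_E)} g`

(Rogawski p. 94 along `α₃`: `MS∖M ≅ NE^*∖NI_E`, the constant absorbing `m(𝐙S∖𝐒)`). Proof: the generic
★ `exists_lintegral_comp_mul_weight_eq_mul_setLIntegral_inter_sup` with `Γ = Eˣ`, `P = Fˣ` (discrete ★ `discreteTopology_principalIdeles`,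
countable), `N(Eˣ) ≤ Fˣ`, and the compact set of `exists_isCompact_principalIdeles_translate_of_ideleRelNorm_mem`.
[cite: Rogawski1990, §7.2 (p. 94)] [cite: CasselsFrohlichANT1967, Ch. VII §6] -/
theorem exists_lintegral_comp_ideleRelNorm_mul_weight_eq_setLIntegral
    (μE : Measure (AdeleRing (𝓞 E) E)ˣ) [IsHaarMeasure μE] (μF : Measure (AdeleRing (𝓞 F) F)ˣ) [IsHaarMeasure μF]
    (hH : IsOpen ((GaloisRepresentations.principalIdeles F ⊔ (AdeleRing.ideleRelNorm F E).range :
      Subgroup (AdeleRing (𝓞 F) F)ˣ) : Set (AdeleRing (𝓞 F) F)ˣ))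
    (hHasse : ∀ k ∈ GaloisRepresentations.principalIdeles F, k ∈ (AdeleRing.ideleRelNorm F E).range →
      ∃ e ∈ GaloisRepresentations.principalIdeles E, AdeleRing.ideleRelNorm F E e = k) :
    ∃ K : ℝ≥0∞, K ≠ 0 ∧ K ≠ ∞ ∧
      ∀ wE : (AdeleRing (𝓞 E) E)ˣ → ℝ≥0∞, IsCoveringWeight (GaloisRepresentations.principalIdeles E) wE →
      ∀ 𝓕 : Set (AdeleRing (𝓞 F) F)ˣ, IsIdeleClassDomain F 𝓕 →
      ∀ g : (AdeleRing (𝓞 F) F)ˣ → ℝ≥0∞, Measurable g →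
        (∀ k ∈ GaloisRepresentations.principalIdeles F, ∀ y, g (k * y) = g y) →
        ∫⁻ x, g (AdeleRing.ideleRelNorm F E x) * wE x ∂μE =
          K * ∫⁻ y in 𝓕 ∩ ↑(GaloisRepresentations.principalIdeles F ⊔ (AdeleRing.ideleRelNorm F E).range), g y ∂μF := by
  obtain ⟨hE1, hE2, hE3⟩ := UnitaryGroup.locallyCompactSpace_secondCountable_t2_idele (E := E)
  obtain ⟨hF1, hF2, hF3⟩ := UnitaryGroup.locallyCompactSpace_secondCountable_t2_idele (E := F)
  haveI := discreteTopology_principalIdeles F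
  haveI := discreteTopology_principalIdeles E
  obtain ⟨C, hC, hcov⟩ := exists_isCompact_principalIdeles_translate_of_ideleRelNorm_mem (F := F) (E := E) hHasse
  obtain ⟨K, hK0, hKt, hK⟩ := exists_lintegral_comp_mul_weight_eq_mul_setLIntegral_inter_sup
    (AdeleRing.ideleRelNorm F E) (GaloisRepresentations.principalIdeles F) (GaloisRepresentations.principalIdeles E)
    (AdeleRing.continuous_ideleRelNorm F E) hH map_principalIdeles_ideleRelNorm_le μE μF hC hcov
  exact ⟨K, hK0, hKt, fun wE hwE 𝓕 h𝓕 g hg hginv => hK wE hwE 𝓕 h𝓕.measurableSet h𝓕.existsUnique g hg hginv⟩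

/-- **The same with an idele class domain on the `E`-side**: for idele class domains `𝓕E` of `E` and `𝓕` of `F` and every
Borel `Fˣ`-invariant `g ≥ 0` on `𝕀_F`, `∫⁻_{𝓕E} g(N x) dμE = K · ∫⁻_{𝓕 ∩ H} g dμF` (the indicator of `𝓕E` is an
`Eˣ`-covering weight, ★ `isCoveringWeight_indicator`; `g ∘ N` is `Eˣ`-invariant since `N(Eˣ) ≤ Fˣ`).
[cite: Rogawski1990, §7.2 (p. 94)] [cite: CasselsFrohlichANT1967, Ch. VII §6] -/
theorem exists_setLIntegral_comp_ideleRelNorm_eq_setLIntegral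
    (μE : Measure (AdeleRing (𝓞 E) E)ˣ) [IsHaarMeasure μE] (μF : Measure (AdeleRing (𝓞 F) F)ˣ) [IsHaarMeasure μF]
    (hH : IsOpen ((GaloisRepresentations.principalIdeles F ⊔ (AdeleRing.ideleRelNorm F E).range :
      Subgroup (AdeleRing (𝓞 F) F)ˣ) : Set (AdeleRing (𝓞 F) F)ˣ))
    (hHasse : ∀ k ∈ GaloisRepresentations.principalIdeles F, k ∈ (AdeleRing.ideleRelNorm F E).range →
      ∃ e ∈ GaloisRepresentations.principalIdeles E, AdeleRing.ideleRelNorm F E e = k) :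
    ∃ K : ℝ≥0∞, K ≠ 0 ∧ K ≠ ∞ ∧
      ∀ 𝓕E : Set (AdeleRing (𝓞 E) E)ˣ, IsIdeleClassDomain E 𝓕E →
      ∀ 𝓕 : Set (AdeleRing (𝓞 F) F)ˣ, IsIdeleClassDomain F 𝓕 →
      ∀ g : (AdeleRing (𝓞 F) F)ˣ → ℝ≥0∞, Measurable g →
        (∀ k ∈ GaloisRepresentations.principalIdeles F, ∀ y, g (k * y) = g y) →
        ∫⁻ x in 𝓕E, g (AdeleRing.ideleRelNorm F E x) ∂μE =
          K * ∫⁻ y in 𝓕 ∩ ↑(GaloisRepresentations.principalIdeles F ⊔ (AdeleRing.ideleRelNorm F E).range), g y ∂μF := by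
  obtain ⟨K, hK0, hKt, hK⟩ :=
    exists_lintegral_comp_ideleRelNorm_mul_weight_eq_setLIntegral (F := F) (E := E) μE μF hH hHasse
  refine ⟨K, hK0, hKt, fun 𝓕E h𝓕E 𝓕 h𝓕 g hg hginv => ?_⟩
  rw [← hK (𝓕E.indicator 1) (isCoveringWeight_indicator h𝓕E.measurableSet h𝓕E.existsUnique) 𝓕 h𝓕 g hg hginv,
    ← lintegral_indicator h𝓕E.measurableSet]
  refine lintegral_congr fun x => ?_
  by_cases hx : x ∈ 𝓕E
  · rw [Set.indicator_of_mem hx, Set.indicator_of_mem hx, Pi.one_apply, mul_one]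
  · rw [Set.indicator_of_notMem hx, Set.indicator_of_notMem hx, mul_zero]

end Literature.NumberTheory.Automorphic
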